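import Literature.Computability.AlgebraicComplexity.AndrewsForbes2022Lemma71Proofs

/-!
# Andrews–Forbes 2022, Proposition 7.2 — the recursive formula generator `G_k`, EXPLICIT and PROVED

R. Andrews, M. A. Forbes, *Ideals, determinants, and straightening: proving and using lower bounds
for polynomial ideals*, STOC 2022 = arXiv:2112.00792 [`AndrewsForbes2022`], §7 "Hardness versus
randomness II: formulas", **Proposition 7.2** (printed p. 50–51; locators `pNNNN:Lnn` are chunk
files of `lit read paper:arxiv-2112.00792`, as in the companion files: statement p0036:L48–L58,
proof p0036:L60–p0037:L47): if `t : ℕ → ℕ` bounds the border formula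
complexity of every bideterminant `(K_σ | K_σ)(X)` from below by `t(σ₁)` and `t(r) ≥ r^{ω(1)}`,
then for every fixed `k` there is an explicit hitting set generator `G_k` for the closure of the
`n`-variate size-`s` formulas with (1) seed length `n^{1/2^k} s^{o(1)}`, (2) `deg G_k = 2^k`,
(3) a (homogeneous) formula of size `n s^{o(1)}`, (4) for `s ≤ n^{O(1)}` a circuit of size
`n log^{O(1)} n`.  The companion statement file `AndrewsForbes2022Applications.lean` (val-lit row
AndrewsForbes2022-B) records Prop. 7.2 as NOT typed there, because every parameter of the printed
sentence is an unnamed `o(1)` / `ω(1)`; its "typable mathematical core is the one-step generator,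
Lemma 7.1, iterated `k` times".  This file types AND PROVES exactly that core, with every constant
explicit — the printed proof (p0036:L60–p0037:L47) made quantitative:

* **The construction** (p0037:L6–L12: "Arrange the variables of `w` into a
  `√n_{k-1} × √n_{k-1}` matrix and let `G_k(Y, Z) := G_{k-1}(𝒢_{√n_{k-1}, √n_{k-1}, r_k}(Y, Z))`"):
  `Proposition72.iterGen F ν r₁ [r_k, …, r_2]` — `G_1 = 𝒢_{ν,ν,r₁}` (Construction 2.8,
  `matrixGenerator`, `n = ν²` variables arranged as a `ν × ν` matrix), and `G_j` is `G_{j-1}` with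
  its `n_{j-1} = 2 ν_{j-2} r_{j-1}` seed variables arranged (injectively, `Proposition72.arrange`)
  into a square matrix of side `ν_{j-1} = ⌈√n_{j-1}⌉` (`Proposition72.ceilSqrt`; print assumes a
  perfect square) and replaced by the entries of `𝒢_{ν_{j-1}, ν_{j-1}, r_j}(Y, Z) = YZ`.
* **The induction step** (p0037:L1–L15), as an abstract composition principle
  (`IsHittingSetGenFor.borderFormula_comp`): if `G` hits the closure of the `M`-variate size-`s`
  formulas and each coordinate of `G` has a fan-in-two formula with `≤ B` gates, and `G'` hits the
  closure of the size-`(s + (s+1)B)` formulas in the seed variables of `G` ("the composition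
  `Φ(G_{k-1}(w))` can be computed by a formula of size `n s^{1+o(1)}`" — here `E(Φ ∘ G) ≤
  E(Φ) + (E(Φ) + 1) · B`, `formulaComplexity_bind₁_le` of `FormulaUnfolding.lean`), then `G ∘ G'`
  hits the closure of the `M`-variate size-`s` formulas ("`𝒢` hits the composition `Φ(G_{k-1}(w))`
  even when `ε = 0`.  Equivalently, `G_k(Y,Z)` hits `Φ`").  The arrangement into a larger square is
  `IsHittingSetGenFor.borderFormula_comp_injective` (renaming along an injection).
* **The parameters** (p0037:L17–L37): seed length `|seed(G_k)| = 2 ν_{k-1} r_k`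
  (`Proposition72.card_iterSeed`; print: "`G_k` has seed length `2 √n_{k-1} r_k`"); degree
  `deg (G_k)_i ≤ 2^k` (`Proposition72.totalDegree_iterGen_le`; print: "`deg(G_k) = 2 deg(G_{k-1})`");
  formula size of every coordinate `E((G_k)_i) ≤ B_k` with `B_1 = 2 r_1`,
  `B_j = B_{j-1} + (B_{j-1} + 1) · 2 r_j`, i.e. `B_k + 1 = (2r_1 + 1) ∏_{j=2}^{k} (2 r_j + 1)`
  (`Proposition72.formulaComplexity_iterGen_le`, `Proposition72.iterFBound_succ`; print: "each
  coordinate of `𝒢_{√n_{k-1},√n_{k-1},r_k}` can be computed by a homogeneous formula of size `2r_k`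
  … composing these formulas gives a formula of size `n s^{o(1)}`").
* **The hitting property** (`Proposition72.iterGen_isHittingSetGenFor`, and the summary
  `AndrewsForbes2022_prop_7_2_explicit`): under the hypothesis of Lemma 7.1 on `t` (monotone, as
  typed in `AndrewsForbes2022_lemma_7_1`), `G_k` is a hitting set generator for the closure of the
  `ν²`-variate fan-in-two formulas with `≤ s` gates over `F((ε))` as soon as
  `t(r_1 + 1) > 2(s+1)ν²` and `t(r_j + 1) > 2(s_j + 1)ν_{j-1}²` for `j = 2, …, k`, where
  `s_j = s + (s+1) B_{j-1}` — print's "`r_k := t⁻¹(n s^{1+o(1)})`" with the constants written out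
  (the `+ 1` in `t(r_j + 1)` is Lemma 7.1's `𝒢_{√n,√n,r-1}` versus Prop. 7.2's `𝒢_{…, r_k}`; the
  gate-count measure and the constant `2(s+1)ν²` are those of the typed Lemma 7.1, whose docstring
  derives them from print's leaf count).  Every field `F` (print: "Let `F` be an arbitrary field").

* **The printed asymptotic form of bullets (1)–(3)** (`AndrewsForbes2022_prop_7_2_asymptotic`,
  section "Asymptotic"): under `t(r) ≥ r^{ω(1)}` (rendered `∀ c ∃ r₀ ∀ r ≥ r₀, r^c ≤ t(r)`), for
  every fixed `k ≥ 1` and `δ > 0`, for all large `s` and all `n = ν² ≤ s` (the regime implicit in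
  print's "`(ns)^{o(1)} ≤ s^{o(1)}`", p0037:L22), the generator with the least admissible ranks
  (`Proposition72.rankFor`, print's `t⁻¹(·)`) hits the closure of the `n`-variate size-`s`
  formulas with seed length `≤ n^{1/2^k} s^δ`, degree `≤ 2^k` and coordinate formula size `≤ s^δ`
  (total `≤ n s^δ`) — the printed parameter analysis p0037:L17–L37 carried out with explicit
  constants (`Proposition72.rankFor_le_rpow`: `t⁻¹(X) ≤ X^η` eventually, for every `η > 0`;
  `Proposition72.exists_params`: the induction on `k`).

What is NOT formalized: the parenthetical "(homogeneous)" reading (the tree has no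
homogeneous-formula size; cf. the typed Lemma 7.1, first half only), and bullet (4) (circuits of
size `n log^{O(1)} n` via Coppersmith's rectangular matrix multiplication [Cop82], not in the
tree).  No named facts are introduced (D-0026); everything here is a definition with a body or a
proved theorem, on top of `AndrewsForbes2022_lemma_7_1_holds` (val-lit p3,
`AndrewsForbes2022Lemma71Proofs.lean`).

Honest framing: kernel-checked transcription of a printed CONDITIONAL hardness-to-randomness
construction (typed literature for the val-lit NP corpus, V4 companion of GAP row N7); VP ≠ VNP is
NOT proved and nothing here is progress on it.  (val-lit t24 g3, 2026-08-26.)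

## References

* [AndrewsForbes2022] R. Andrews, M. A. Forbes, STOC 2022, doi:10.1145/3519935.3520025,
  arXiv:2112.00792 — Prop. 7.2 (p. 50–51), Lemma 7.1 (p. 50), Construction 2.8 (p. 13).
* [BurgisserClausenShokrollahi1997] P. Bürgisser, M. Clausen, M. A. Shokrollahi, *Algebraic
  Complexity Theory*, Springer 1997, §21.1 (formula size calculus, via `FormulaUnfolding.lean`).
-/

noncomputable section

open MvPolynomial

namespace Literature.Computability.AlgebraicComplexity

universe u v w

/-! ## Formula-size bookkeeping: sums, variables, the coordinates of `𝒢_{n,m,r}` -/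

section FormulaSize

variable {k : Type u} [CommSemiring k] {σ : Type v}

/-- A variable is a fan-in-two formula with no gates: `E(X_i) = 0`. [cite: BurgisserClausenShokrollahi1997, (21.19)] -/
theorem formulaComplexity_X_eq_zero (i : σ) : formulaComplexity (X i : MvPolynomial σ k) = 0 := by
  have h := (exists_wexpr_iff_formulaComplexity_le (X i : MvPolynomial σ k) 0).mp
    ⟨.var i, WExpr.eval_var i, le_rfl⟩
  omega

/-- Sums: `E(∑_{i ∈ s} u_i) ≤ ∑_{i ∈ s} (E(u_i) + 1)` (one addition gate per summand).
[cite: BurgisserClausenShokrollahi1997, §21.1 p. 549] -/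
theorem formulaComplexity_finset_sum_le {ι : Type w} (s : Finset ι) (u : ι → MvPolynomial σ k) :
    formulaComplexity (∑ i ∈ s, u i) ≤ ∑ i ∈ s, (formulaComplexity (u i) + 1) := by
  classical
  induction s using Finset.induction_on with
  | empty =>
    rw [Finset.sum_empty, Finset.sum_empty]
    have h := (exists_wexpr_iff_formulaComplexity_le (0 : MvPolynomial σ k) 0).mp
      ⟨.const 0, by simp, le_rfl⟩
    omega
  | insert a s ha ih =>
    rw [Finset.sum_insert ha, Finset.sum_insert ha]
    refine (formulaComplexity_add_le _ _).trans ?_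
    omega

variable (k) in
/-- **Lemma 2.9 (3), formula clause** (p0013:L51: "each coordinate of the output can be computed
by a homogeneous formula of size `2r`"; used in the proof of Prop. 7.2, p0037:L35): the coordinate
`∑_{l<r} y_{i,l} z_{l,j}` of `𝒢_{n,m,r}` has a fan-in-two formula with at most `2r` gates (`r`
products, `r` additions; print's `2r` counts leaves). [cite: AndrewsForbes2022, Lemma 2.9 (3)] -/
theorem formulaComplexity_matrixGenerator_le (F : Type u) [Field F] (n m r : ℕ)
    (ij : Fin n × Fin m) : formulaComplexity (matrixGenerator F n m r ij) ≤ 2 * r := by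
  unfold matrixGenerator
  refine (formulaComplexity_finset_sum_le _ _).trans ?_
  have h1 : ∀ l : Fin r, formulaComplexity
      (X (Sum.inl (ij.1, l)) * X (Sum.inr (l, ij.2)) : MvPolynomial (MatGenSeed n m r) F) + 1 ≤ 2 := by
    intro l
    have := formulaComplexity_mul_le (X (Sum.inl (ij.1, l)) : MvPolynomial (MatGenSeed n m r) F)
      (X (Sum.inr (l, ij.2)))
    rw [formulaComplexity_X_eq_zero, formulaComplexity_X_eq_zero] at this
    omega
  calc ∑ l : Fin r, (formulaComplexity
        (X (Sum.inl (ij.1, l)) * X (Sum.inr (l, ij.2)) : MvPolynomial (MatGenSeed n m r) F) + 1)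
      ≤ ∑ _l : Fin r, 2 := Finset.sum_le_sum fun l _ => h1 l
    _ = 2 * r := by simp [mul_comm]

end FormulaSize

/-! ## The induction step of Prop. 7.2: composition of hitting set generators for closures of formulas -/

section Composition

variable {F : Type u} [Field F]

/-- Degree of a substitution: if every `θ i` has total degree `≤ δ` then `deg p(θ) ≤ (deg p) · δ`
(used for "`deg(G_k) = 2 deg(G_{k-1})`", p0037:L31). [cite: AndrewsForbes2022, Prop. 7.2 (proof, "Degree")] -/
theorem Proposition72.totalDegree_bind₁_le_mul_of_le {R : Type u} [CommSemiring R] {ι : Type v}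
    {κ : Type w} (θ : ι → MvPolynomial κ R) (δ : ℕ) (hθ : ∀ i, (θ i).totalDegree ≤ δ)
    (p : MvPolynomial ι R) : (bind₁ θ p).totalDegree ≤ p.totalDegree * δ := by
  classical
  conv_lhs => rw [p.as_sum]
  rw [map_sum]
  refine (totalDegree_finsetSum _ _).trans (Finset.sup_le fun d hd => ?_)
  rw [bind₁_monomial]
  refine (totalDegree_mul _ _).trans ?_
  rw [totalDegree_C, zero_add]
  refine (totalDegree_finsetProd _ _).trans ?_
  calc ∑ i ∈ d.support, (θ i ^ d i).totalDegree
      ≤ ∑ i ∈ d.support, d i * δ :=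
        Finset.sum_le_sum fun i _ => (totalDegree_pow _ _).trans (Nat.mul_le_mul_left _ (hθ i))
    _ = (d.sum fun _ e => e) * δ := by rw [Finsupp.sum, Finset.sum_mul]
    _ ≤ p.totalDegree * δ := Nat.mul_le_mul_right _ (le_totalDegree hd)

/-- Renaming along a map is free for formulas: `E(rename ι h) ≤ E(h)` (relabel the leaves).
[cite: BurgisserClausenShokrollahi1997, §21.1 p. 549] -/
theorem formulaComplexity_rename_le {k : Type u} [CommSemiring k] {σ : Type v} {τ : Type w}
    (ι : σ → τ) (h : MvPolynomial σ k) :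
    formulaComplexity (rename ι h) ≤ formulaComplexity h := by
  have hre : rename ι h = bind₁ (fun i => (X (ι i) : MvPolynomial τ k)) h := by
    refine AlgHom.congr_fun (MvPolynomial.algHom_ext fun i => ?_) h
    simp only [rename_X, bind₁_X_right]
  rw [hre]
  refine (formulaComplexity_bind₁_le (B := 0) (fun i => ?_) h).trans (by omega)
  rw [formulaComplexity_X_eq_zero]

/-- `O(ε^k)` coefficientwise is preserved by renaming the variables. [cite: AndrewsForbes2022, Def. 2.1] -/
theorem polyOrdGE_rename {σ : Type v} {τ : Type w} {k : ℤ}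
    {p : MvPolynomial σ (LaurentSeries F)} (hp : PolyOrdGE k p) (ι : σ → τ) :
    PolyOrdGE k (rename ι p) := by
  have hre : rename ι p = bind₁ (fun i => (X (ι i) : MvPolynomial τ (LaurentSeries F))) p := by
    refine AlgHom.congr_fun (MvPolynomial.algHom_ext fun i => ?_) p
    simp only [rename_X, bind₁_X_right]
  rw [hre]
  exact hp.bind₁ fun i => PolyOrdGE.X (ι i)

/-- The closure of the size-`s` formulas is stable under renaming the variables along any map
(rename the approximating formula; its size does not grow). [cite: AndrewsForbes2022, §2.1 (closure of a class)] -/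
theorem rename_mem_borderClass_formulaClass {σ : Type v} {τ : Type w} {s : ℕ}
    {f : MvPolynomial σ F} (hf : f ∈ borderClass F (formulaClass (LaurentSeries F) σ s))
    (ι : σ → τ) : rename ι f ∈ borderClass F (formulaClass (LaurentSeries F) τ s) := by
  obtain ⟨h, hh, hhf⟩ := hf
  refine ⟨rename ι h, ?_, ?_⟩
  · change formulaComplexity (rename ι h) ≤ s
    exact (formulaComplexity_rename_le ι h).trans hh
  · have : rename ι h - MvPolynomial.map (algebraMap F (LaurentSeries F)) (rename ι f) =
        rename ι (h - MvPolynomial.map (algebraMap F (LaurentSeries F)) f) := by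
      rw [map_sub, map_rename]
    rw [this]
    exact polyOrdGE_rename hhf ι

/-- **Arranging the seed into a larger set of variables** (proof of Prop. 7.2, p0037:L6:
"Arrange the variables of `w` into a `√n_{k-1} × √n_{k-1}` matrix"): if `G : τ' → F[y]` hits the
closure of the `τ'`-variate size-`s` formulas and `ι : τ ↪ τ'` is injective, then `G ∘ ι` hits the
closure of the `τ`-variate size-`s` formulas (a nonzero `g(w)` stays nonzero and in the class after
renaming `w_i ↦ x_{ι i}`, and `g(G ∘ ι) = (rename ι g)(G)`). [cite: AndrewsForbes2022, Prop. 7.2 (proof)] -/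
theorem IsHittingSetGenFor.borderFormula_comp_injective {τ : Type v} {τ' : Type w} {κ : Type}
    {s : ℕ} {G : τ' → MvPolynomial κ F}
    (hG : IsHittingSetGenFor F (borderClass F (formulaClass (LaurentSeries F) τ' s)) G)
    {ι : τ → τ'} (hι : Function.Injective ι) :
    IsHittingSetGenFor F (borderClass F (formulaClass (LaurentSeries F) τ s)) (G ∘ ι) := by
  intro g hg hg0
  rw [← bind₁_rename]
  exact hG (rename ι g) (rename_mem_borderClass_formulaClass hg ι)
    (fun h0 => hg0 (rename_injective ι hι (by rw [h0, map_zero])))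

/-- **The induction step of Prop. 7.2** (p0037:L1–L15), as a composition principle for hitting
set generators of closures of formulas: let `G : M → F[w]` hit the closure of the `M`-variate
formulas with `≤ s` gates, each coordinate `G_m` having a fan-in-two formula with `≤ B` gates, and
let `G' : τ → F[y]` hit the closure of the formulas with `≤ s + (s+1)B` gates in the seed
variables `w` of `G`.  Then `G ∘ G'` (`x_m ↦ G_m(G'(y))`) hits the closure of the `M`-variate
formulas with `≤ s` gates.  Printed argument: for `Φ = f + O(ε)` of size `s` with `f ≠ 0`,
`f(G(w)) ≠ 0` ("`G_{k-1}` hits `Φ` even when `ε = 0`"), and `Φ(G(w)) = f(G(w)) + O(ε)` is a formula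
of size `≤ s + (s+1)B` (substitute formulas for the `G_m` into the `≤ s + 1` leaves;
`formulaComplexity_bind₁_le`), so `G'` hits it: `f(G(G'(y))) ≠ 0`.
[cite: AndrewsForbes2022, Prop. 7.2 (proof)] -/
theorem IsHittingSetGenFor.borderFormula_comp {M : Type v} {τ : Type w} {τ' : Type} {s B : ℕ}
    {G : M → MvPolynomial τ F} {G' : τ → MvPolynomial τ' F}
    (hG : IsHittingSetGenFor F (borderClass F (formulaClass (LaurentSeries F) M s)) G)
    (hB : ∀ m, formulaComplexity (G m) ≤ B)
    (hG' : IsHittingSetGenFor F (borderClass F (formulaClass (LaurentSeries F) τ (s + (s + 1) * B))) G') :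
    IsHittingSetGenFor F (borderClass F (formulaClass (LaurentSeries F) M s))
      (fun m => bind₁ G' (G m)) := by
  intro f hf hf0
  rw [← bind₁_bind₁]
  obtain ⟨h, hh, hhf⟩ := hf
  change formulaComplexity h ≤ s at hh
  -- `g = f(G(w)) ≠ 0` by the hitting property of `G`
  have hg0 : bind₁ G f ≠ 0 := hG f ⟨h, hh, hhf⟩ hf0
  -- `Φ(G(w)) = g + O(ε)` is a formula with `≤ s + (s+1) B` gates
  have hmem : bind₁ G f ∈ borderClass F (formulaClass (LaurentSeries F) τ (s + (s + 1) * B)) := by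
    refine ⟨bind₁ (fun m => MvPolynomial.map (algebraMap F (LaurentSeries F)) (G m)) h, ?_, ?_⟩
    · change formulaComplexity _ ≤ _
      refine (formulaComplexity_bind₁_le (B := B) (fun m => ?_) h).trans ?_
      · exact (formulaComplexity_map_le _ _).trans (hB m)
      · exact Nat.add_le_add hh (Nat.mul_le_mul_right _ (Nat.succ_le_succ hh))
    · rw [map_bind₁, ← map_sub]
      exact hhf.bind₁ fun m => PolyOrdGE.map_algebraMap (G m)
  exact hG' _ hmem hg0

end Composition

/-! ## The construction of Prop. 7.2: `⌈√·⌉`, the arrangement, the iterated generator `G_k` -/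

namespace Proposition72

/-- `⌈√N⌉`: the least `ν` with `N ≤ ν²` (the side of the square matrix into which `N` seed
variables are arranged, p0037:L6; print takes `√n_{k-1}`). [cite: AndrewsForbes2022, Prop. 7.2 (proof)] -/
def ceilSqrt (N : ℕ) : ℕ := Nat.find (⟨N, Nat.le_mul_self N⟩ : ∃ ν : ℕ, N ≤ ν * ν)

/-- Defining property of `⌈√N⌉`: `N ≤ ⌈√N⌉²`. [cite: AndrewsForbes2022, Prop. 7.2 (proof)] -/
theorem le_ceilSqrt_mul_self (N : ℕ) : N ≤ ceilSqrt N * ceilSqrt N :=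
  Nat.find_spec (⟨N, Nat.le_mul_self N⟩ : ∃ ν : ℕ, N ≤ ν * ν)

/-- Minimality of `⌈√N⌉`: `⌈√N⌉ ≤ ν ↔ N ≤ ν²`. [cite: AndrewsForbes2022, Prop. 7.2 (proof)] -/
theorem ceilSqrt_le_iff {N ν : ℕ} : ceilSqrt N ≤ ν ↔ N ≤ ν * ν := by
  unfold ceilSqrt
  rw [Nat.find_le_iff]
  constructor
  · rintro ⟨m, hm, hNm⟩
    exact hNm.trans (Nat.mul_le_mul hm hm)
  · intro h
    exact ⟨ν, le_rfl, h⟩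

/-- `⌈√(ν²)⌉ = ν` (the first step arranges `n = ν²` variables as a `ν × ν` matrix exactly).
[cite: AndrewsForbes2022, Prop. 7.2 (proof)] -/
theorem ceilSqrt_mul_self (ν : ℕ) : ceilSqrt (ν * ν) = ν := by
  refine le_antisymm (ceilSqrt_le_iff.mpr le_rfl) ?_
  rcases lt_or_ge (ceilSqrt (ν * ν)) ν with h | h
  · have h1 := le_ceilSqrt_mul_self (ν * ν)
    have h2 : ceilSqrt (ν * ν) * ceilSqrt (ν * ν) < ν * ν := Nat.mul_self_lt_mul_self h
    omega
  · exact h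

/-- The crude bound `⌈√N⌉ ≤ N` (`N ≤ N²` for `N ≥ 1`, and `⌈√0⌉ = 0`), enough for the seed-length
bookkeeping below. [cite: AndrewsForbes2022, Prop. 7.2 (proof)] -/
theorem ceilSqrt_le_self (N : ℕ) : ceilSqrt N ≤ N := by
  rcases Nat.eq_zero_or_pos N with rfl | hN
  · exact ceilSqrt_le_iff.mpr le_rfl
  · exact ceilSqrt_le_iff.mpr (Nat.le_mul_of_pos_left N hN)

/-- The seed `(Y, Z) ∈ F^{n×r} × F^{r×m}` of `𝒢_{n,m,r}` enumerated: `MatGenSeed n m r ≃ Fin (nr + rm)`.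
[cite: AndrewsForbes2022, Construction 2.8] -/
def matGenSeedEquivFin (n m r : ℕ) : MatGenSeed n m r ≃ Fin (n * r + r * m) :=
  (Equiv.sumCongr finProdFinEquiv finProdFinEquiv).trans finSumFinEquiv

/-- Seed length of `𝒢_{n,m,r} : F^{n × r} × F^{r × m} → F^{n × m}` (Construction 2.8, p0013:L36):
`nr + rm`. [cite: AndrewsForbes2022, Construction 2.8] -/
theorem card_matGenSeed (n m r : ℕ) : Fintype.card (MatGenSeed n m r) = n * r + r * m := by
  simp [Fintype.card_sum, Fintype.card_prod, Fintype.card_fin]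

/-- **The arrangement** (p0037:L6): the `2ar` seed variables `(Y, Z)` of `𝒢_{a,a,r}` placed
injectively into a square matrix of side `⌈√(2ar)⌉` (row-major after the enumeration
`matGenSeedEquivFin`; unused entries of the square are simply not seed variables).
[cite: AndrewsForbes2022, Prop. 7.2 (proof)] -/
def arrange (a r : ℕ) :
    MatGenSeed a a r → Fin (ceilSqrt (a * r + r * a)) × Fin (ceilSqrt (a * r + r * a)) :=
  fun i => finProdFinEquiv.symm (Fin.castLE (le_ceilSqrt_mul_self _) (matGenSeedEquivFin a a r i))

/-- The arrangement is injective. [cite: AndrewsForbes2022, Prop. 7.2 (proof)] -/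
theorem arrange_injective (a r : ℕ) : Function.Injective (arrange a r) := by
  intro i j hij
  unfold arrange at hij
  have := Fin.castLE_injective (le_ceilSqrt_mul_self (a * r + r * a))
    (finProdFinEquiv.symm.injective hij)
  exact (matGenSeedEquivFin a a r).injective this

/-- The rank parameter of the LAST step of `G_k`: `r_k` (`r₁` for `k = 1`); the list
`[r_k, …, r_2]` carries the later steps, most recent first. [cite: AndrewsForbes2022, Prop. 7.2 (proof)] -/
def lastRank (r₁ : ℕ) : List ℕ → ℕ
  | [] => r₁
  | r :: _ => r

/-- The side `ν_{k-1}` of the square matrix of the LAST step of `G_k` (`ν` for `k = 1`, then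
`ν_{j} = ⌈√(2 ν_{j-1} r_j)⌉`, the side of the square holding the `2 ν_{j-1} r_j` seed variables of
`G_j`). [cite: AndrewsForbes2022, Prop. 7.2 (proof)] -/
def lastSide (ν r₁ : ℕ) : List ℕ → ℕ
  | [] => ν
  | _ :: rs => ceilSqrt (lastSide ν r₁ rs * lastRank r₁ rs + lastRank r₁ rs * lastSide ν r₁ rs)

/-- The seed variables of `G_k = iterGen ν r₁ [r_k, …, r_2]`: the entries of
`(Y, Z) ∈ F^{ν_{k-1} × r_k} × F^{r_k × ν_{k-1}}`. [cite: AndrewsForbes2022, Prop. 7.2 (proof)] -/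
abbrev IterSeed (ν r₁ : ℕ) (rs : List ℕ) : Type :=
  MatGenSeed (lastSide ν r₁ rs) (lastSide ν r₁ rs) (lastRank r₁ rs)

variable (F : Type u) [Field F]

/-- **The generator `G_k` of Prop. 7.2** (p0036:L62–p0037:L12), with explicit rank parameters:
`iterGen ν r₁ [] = G_1 = 𝒢_{ν,ν,r₁}(Y, Z) = YZ` on the `ν × ν = n` output variables, and
`iterGen ν r₁ (r :: rs) = G_{k}(Y, Z) := G_{k-1}(𝒢_{ν_{k-1}, ν_{k-1}, r}(Y, Z))`, the seed of
`G_{k-1} = iterGen ν r₁ rs` being arranged into a `ν_{k-1} × ν_{k-1}` matrix (`arrange`).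
[cite: AndrewsForbes2022, Prop. 7.2 (proof)] -/
def iterGen (ν r₁ : ℕ) : (rs : List ℕ) → (Fin ν × Fin ν → MvPolynomial (IterSeed ν r₁ rs) F)
  | [] => matrixGenerator F ν ν r₁
  | r :: rs => fun m =>
      bind₁ (fun i => matrixGenerator F _ _ r (arrange (lastSide ν r₁ rs) (lastRank r₁ rs) i))
        (iterGen ν r₁ rs m)

/-- The formula-size bound `B_k` for the coordinates of `G_k`: `B_1 = 2r_1`,
`B_j = B_{j-1} + (B_{j-1} + 1) · 2r_j` (substitute the `2r_j`-gate coordinates of `𝒢_{…, r_j}`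
into the `≤ B_{j-1} + 1` leaves). [cite: AndrewsForbes2022, Prop. 7.2 (proof, "Formula size")] -/
def iterFBound (r₁ : ℕ) : List ℕ → ℕ
  | [] => 2 * r₁
  | r :: rs => iterFBound r₁ rs + (iterFBound r₁ rs + 1) * (2 * r)

/-- **The explicit hypothesis on the rank parameters** replacing print's `r_k := t⁻¹(n s^{1+o(1)})`
(p0037:L12): `t(r_1 + 1) > 2(s+1)ν²` (Lemma 7.1 for `G_1`), and for each later step `j`,
`t(r_j + 1) > 2(s_j + 1)ν_{j-1}²` with `s_j = s + (s+1)B_{j-1}` the size of the compositions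
`Φ ∘ G_{j-1}` and `ν_{j-1}` the side of the square holding the seed of `G_{j-1}` (Lemma 7.1 for
the inner generator). [cite: AndrewsForbes2022, Prop. 7.2 (proof)] -/
def IterHyp (t : ℕ → ℕ) (s ν r₁ : ℕ) : List ℕ → Prop
  | [] => 2 * (s + 1) * (ν * ν) < t (r₁ + 1)
  | r :: rs => IterHyp t s ν r₁ rs ∧
      2 * (s + (s + 1) * iterFBound r₁ rs + 1) *
          (lastSide ν r₁ (r :: rs) * lastSide ν r₁ (r :: rs)) < t (r + 1)

variable {F}

/-- **Seed length** (Prop. 7.2 (1) made explicit; p0037:L18: "`G_k` has seed length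
`2√n_{k-1} r_k`"): `|seed(G_k)| = ν_{k-1} r_k + r_k ν_{k-1} = 2 ν_{k-1} r_k`.
[cite: AndrewsForbes2022, Prop. 7.2 (1)] -/
theorem card_iterSeed (ν r₁ : ℕ) (rs : List ℕ) :
    Fintype.card (IterSeed ν r₁ rs) = 2 * (lastSide ν r₁ rs * lastRank r₁ rs) :=
  (card_matGenSeed _ _ _).trans (by ring)

/-- The sides do not outgrow the seed lengths: `ν_j ≤ 2 ν_{j-1} r_j` (`⌈√N⌉ ≤ N`).
[cite: AndrewsForbes2022, Prop. 7.2 (proof, "Seed length")] -/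
theorem lastSide_cons_le (ν r₁ r : ℕ) (rs : List ℕ) :
    lastSide ν r₁ (r :: rs) ≤ 2 * (lastSide ν r₁ rs * lastRank r₁ rs) := by
  change ceilSqrt _ ≤ _
  refine (ceilSqrt_le_self _).trans (le_of_eq ?_)
  ring

/-- **Degree** (Prop. 7.2 (2); p0037:L30–L32: "Clearly `deg(G_k) = 2 deg(G_{k-1})` … so
`deg(G_k) = 2^k`"; the upper bound is what is typed): every coordinate of `G_k` has total degree
`≤ 2^k`. [cite: AndrewsForbes2022, Prop. 7.2 (2)] -/
theorem totalDegree_iterGen_le (ν r₁ : ℕ) :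
    ∀ (rs : List ℕ) (m : Fin ν × Fin ν), (iterGen F ν r₁ rs m).totalDegree ≤ 2 ^ (rs.length + 1)
  | [], m => le_trans
      (totalDegree_matrixGenerator_le ν ν r₁ m : (iterGen F ν r₁ [] m).totalDegree ≤ 2)
      (by norm_num)
  | r :: rs, m => by
    rw [iterGen, List.length_cons, pow_succ]
    refine (totalDegree_bind₁_le_mul_of_le _ 2 (fun i => totalDegree_matrixGenerator_le _ _ _ _)
      _).trans ?_
    exact Nat.mul_le_mul_right 2 (totalDegree_iterGen_le ν r₁ rs m)

/-- **Formula size** (Prop. 7.2 (3) made explicit; p0037:L35–L37): every coordinate of `G_k` has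
a fan-in-two formula with at most `B_k` gates (`iterFBound`). [cite: AndrewsForbes2022, Prop. 7.2 (3)] -/
theorem formulaComplexity_iterGen_le (ν r₁ : ℕ) :
    ∀ (rs : List ℕ) (m : Fin ν × Fin ν), formulaComplexity (iterGen F ν r₁ rs m) ≤ iterFBound r₁ rs
  | [], m =>
    (formulaComplexity_matrixGenerator_le F ν ν r₁ m : formulaComplexity (iterGen F ν r₁ [] m) ≤ 2 * r₁)
  | r :: rs, m => by
    rw [iterGen, iterFBound]
    have ih := formulaComplexity_iterGen_le ν r₁ rs m
    refine (formulaComplexity_bind₁_le (B := 2 * r)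
      (fun i => formulaComplexity_matrixGenerator_le F _ _ r _) _).trans ?_
    exact Nat.add_le_add ih (Nat.mul_le_mul_right _ (Nat.succ_le_succ ih))

/-- Closed form of the size bound: `B_k + 1 = (2r_1 + 1) · ∏_{j ≥ 2} (2r_j + 1)` (each step
multiplies the leaf count by `2r_j + 1`). [cite: AndrewsForbes2022, Prop. 7.2 (proof, "Formula size")] -/
theorem iterFBound_succ (r₁ : ℕ) :
    ∀ rs : List ℕ, iterFBound r₁ rs + 1 = (2 * r₁ + 1) * (rs.map fun r => 2 * r + 1).prod
  | [] => by simp [iterFBound]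
  | r :: rs => by
    have ih := iterFBound_succ r₁ rs
    rw [iterFBound, List.map_cons, List.prod_cons]
    calc iterFBound r₁ rs + (iterFBound r₁ rs + 1) * (2 * r) + 1
        = (iterFBound r₁ rs + 1) * (2 * r + 1) := by ring
      _ = (2 * r₁ + 1) * (rs.map fun r => 2 * r + 1).prod * (2 * r + 1) := by rw [ih]
      _ = (2 * r₁ + 1) * ((2 * r + 1) * (rs.map fun r => 2 * r + 1).prod) := by ring

/-- **`G_k` is a hitting set generator for the closure of the `n`-variate size-`s` formulas**
(Prop. 7.2, main clause, with explicit parameters; every field): under the hypothesis of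
Lemma 7.1 on `t` and the explicit thresholds `IterHyp t s ν r₁ rs` on the ranks, the generator
`G_k = iterGen ν r₁ rs` hits the closure of the `ν²`-variate fan-in-two formulas with `≤ s` gates
over `F((ε))`.  Proof = the printed induction (p0036:L62–p0037:L15): `k = 1` is Lemma 7.1
(`AndrewsForbes2022_lemma_7_1_holds`); the step is Lemma 7.1 for the inner generator
`𝒢_{ν_{k-1},ν_{k-1},r_k}` on the `ν_{k-1}²`-variate formulas of size `s_k = s + (s+1)B_{k-1}`,
transported to the seed of `G_{k-1}` along the arrangement
(`IsHittingSetGenFor.borderFormula_comp_injective`) and composed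
(`IsHittingSetGenFor.borderFormula_comp`). [cite: AndrewsForbes2022, Prop. 7.2] -/
theorem iterGen_isHittingSetGenFor {F : Type} [Field F] {t : ℕ → ℕ} (ht : Monotone t)
    (hyp : ∀ (n' m' : ℕ) (σ : Multiset ℕ), σ ≠ 0 → (∀ p ∈ σ, 0 < p ∧ p ≤ min n' m') →
      t σ.sup ≤ borderFormulaComplexity F (kBideterminant F n' m' σ))
    (s ν r₁ : ℕ) :
    ∀ rs : List ℕ, IterHyp t s ν r₁ rs →
      IsHittingSetGenFor F (borderClass F (formulaClass (LaurentSeries F) (Fin ν × Fin ν) s))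
        (iterGen F ν r₁ rs)
  | [], h => by
    have h71 := AndrewsForbes2022_lemma_7_1_holds F t ht hyp ν s (r₁ + 1) (Nat.succ_pos r₁) h
    rwa [Nat.add_sub_cancel] at h71
  | r :: rs, ⟨hrs, hr⟩ => by
    have ih := iterGen_isHittingSetGenFor ht hyp s ν r₁ rs hrs
    -- Lemma 7.1 for the inner generator `𝒢_{ν', ν', r}` on the `ν'²`-variate size-`s'` formulas
    have h71 := AndrewsForbes2022_lemma_7_1_holds F t ht hyp (lastSide ν r₁ (r :: rs))
      (s + (s + 1) * iterFBound r₁ rs) (r + 1) (Nat.succ_pos r) hr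
    rw [Nat.add_sub_cancel] at h71
    -- transported to the seed variables of `G_{k-1}` along the arrangement, then composed
    exact ih.borderFormula_comp (formulaComplexity_iterGen_le ν r₁ rs)
      (h71.borderFormula_comp_injective (arrange_injective _ _))

end Proposition72

open Proposition72 in
/-- **Andrews–Forbes 2022, Proposition 7.2 — explicit form, PROVED** (every field `F`).  Let
`t : ℕ → ℕ` be monotone with `t(σ₁) ≤` the border formula complexity of `(K_σ | K_σ)(X)` for every
shape `σ` (the hypothesis of Lemma 7.1 / Prop. 7.2 as typed in `AndrewsForbes2022_lemma_7_1`).  For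
`n = ν²` variables, a size bound `s`, and rank parameters `r_1` and `[r_k, …, r_2]` satisfying the
explicit thresholds `IterHyp` (print: `r_k := t⁻¹(n s^{1+o(1)})`), the generator
`G_k = iterGen ν r₁ [r_k, …, r_2]` of the printed proof satisfies:
(hitting) `G_k` is a hitting set generator for the closure of the `n`-variate fan-in-two formulas
with `≤ s` gates; (1) seed length `2 ν_{k-1} r_k` (print: `2√n_{k-1} r_k = n^{1/2^k} s^{o(1)}`);
(2) every coordinate has degree `≤ 2^k` (print: `deg G_k = 2^k`); (3) every coordinate has a
fan-in-two formula with `≤ B_k` gates, `B_k + 1 = ∏_j (2r_j + 1)` (print: a formula of size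
`n s^{o(1)}` for all `n` coordinates together).  Print's bullet (4) (circuit size `n log^{O(1)} n`,
Coppersmith) is not formalized; the asymptotic choice of the `r_j` under `t(r) ≥ r^{ω(1)}` is
`AndrewsForbes2022_prop_7_2_asymptotic` below. [cite: AndrewsForbes2022, Prop. 7.2] -/
theorem AndrewsForbes2022_prop_7_2_explicit (F : Type) [Field F] (t : ℕ → ℕ) (ht : Monotone t)
    (hyp : ∀ (n' m' : ℕ) (σ : Multiset ℕ), σ ≠ 0 → (∀ p ∈ σ, 0 < p ∧ p ≤ min n' m') →
      t σ.sup ≤ borderFormulaComplexity F (kBideterminant F n' m' σ))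
    (s ν r₁ : ℕ) (rs : List ℕ) (h : IterHyp t s ν r₁ rs) :
    IsHittingSetGenFor F (borderClass F (formulaClass (LaurentSeries F) (Fin ν × Fin ν) s))
        (iterGen F ν r₁ rs) ∧
      Fintype.card (IterSeed ν r₁ rs) = 2 * (lastSide ν r₁ rs * lastRank r₁ rs) ∧
      (∀ m, (iterGen F ν r₁ rs m).totalDegree ≤ 2 ^ (rs.length + 1)) ∧
      (∀ m, formulaComplexity (iterGen F ν r₁ rs m) ≤ iterFBound r₁ rs) ∧
      iterFBound r₁ rs + 1 = (2 * r₁ + 1) * (rs.map fun r => 2 * r + 1).prod :=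
  ⟨iterGen_isHittingSetGenFor ht hyp s ν r₁ rs h, card_iterSeed ν r₁ rs,
    totalDegree_iterGen_le ν r₁ rs, formulaComplexity_iterGen_le ν r₁ rs, iterFBound_succ r₁ rs⟩

/-! ## The printed asymptotic form of Prop. 7.2 (1)–(3) under `t(r) ≥ r^{ω(1)}` -/

section Asymptotic

namespace Proposition72

/-- **The least admissible rank** for a threshold `X`: `rankFor t X = min {r : X < t(r + 1)}`
(print's `r_k := t⁻¹(·)`, p0037:L12, made definite; junk `0` if no such `r`).
[cite: AndrewsForbes2022, Prop. 7.2 (proof)] -/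
def rankFor (t : ℕ → ℕ) (X : ℕ) : ℕ := sInf {r | X < t (r + 1)}

/-- `t` unbounded ⇒ the least admissible rank is admissible. [cite: AndrewsForbes2022, Prop. 7.2 (proof)] -/
theorem lt_rankFor_spec {t : ℕ → ℕ} (hunb : ∀ X, ∃ r, X < t (r + 1)) (X : ℕ) :
    X < t (rankFor t X + 1) :=
  Nat.sInf_mem (s := {r | X < t (r + 1)}) (hunb X)

/-- Minimality of `rankFor`. [cite: AndrewsForbes2022, Prop. 7.2 (proof)] -/
theorem rankFor_le {t : ℕ → ℕ} {X R : ℕ} (h : X < t (R + 1)) : rankFor t X ≤ R :=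
  Nat.sInf_le h

/-- `rankFor` is monotone in the threshold. [cite: AndrewsForbes2022, Prop. 7.2 (proof)] -/
theorem rankFor_mono {t : ℕ → ℕ} (hunb : ∀ X, ∃ r, X < t (r + 1)) {X X' : ℕ} (h : X ≤ X') :
    rankFor t X ≤ rankFor t X' :=
  rankFor_le (h.trans_lt (lt_rankFor_spec hunb X'))

/-- A super-polynomial `t` (print: `t(r) ≥ r^{ω(1)}`, rendered `∀ c ∃ r₀ ∀ r ≥ r₀, r^c ≤ t(r)`) is
unbounded. [cite: AndrewsForbes2022, Prop. 7.2 (hypothesis)] -/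
theorem unbounded_of_superpolynomial {t : ℕ → ℕ}
    (hsp : ∀ c : ℕ, ∃ r₀ : ℕ, ∀ r, r₀ ≤ r → r ^ c ≤ t r) (X : ℕ) : ∃ r, X < t (r + 1) := by
  obtain ⟨r₀, hr₀⟩ := hsp 1
  refine ⟨max r₀ X, ?_⟩
  have := hr₀ (max r₀ X + 1) (by omega)
  rw [pow_one] at this
  omega

/-- **`t(r) ≥ r^{ω(1)}` ⇒ `t⁻¹(X) ≤ X^{o(1)}`** (p0037:L21–L22: "`r_k = t⁻¹(n s^{1+o(1)}) ≤ (ns)^{o(1)}`"):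
for every `η > 0`, `rankFor t X ≤ X^η` for all large `X`. [cite: AndrewsForbes2022, Prop. 7.2 (proof, "Seed length")] -/
theorem rankFor_le_rpow {t : ℕ → ℕ} (hsp : ∀ c : ℕ, ∃ r₀ : ℕ, ∀ r, r₀ ≤ r → r ^ c ≤ t r)
    {η : ℝ} (hη : 0 < η) :
    ∃ X₀ : ℕ, ∀ X : ℕ, X₀ ≤ X → (rankFor t X : ℝ) ≤ (X : ℝ) ^ η := by
  -- an integer `c` with `1 < η c`
  obtain ⟨c, hc⟩ : ∃ c : ℕ, 1 < η * c := by
    obtain ⟨c, hc⟩ := exists_nat_gt (1 / η)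
    refine ⟨c, ?_⟩
    rw [div_lt_iff₀ hη] at hc
    linarith
  have hc0 : c ≠ 0 := by
    rintro rfl
    norm_num at hc
  obtain ⟨r₀, hr₀⟩ := hsp c
  refine ⟨max 1 ⌈((r₀ : ℝ) ^ (1 / η))⌉₊, fun X hX => ?_⟩
  have hX1 : (1 : ℝ) ≤ X := by exact_mod_cast (le_max_left _ _).trans hX
  have hX0 : (0 : ℝ) ≤ X := by positivity
  obtain ⟨R, hR⟩ : ∃ R : ℕ, R = ⌊(X : ℝ) ^ η⌋₊ := ⟨_, rfl⟩
  have hRlt : (X : ℝ) ^ η < R + 1 := by rw [hR]; exact Nat.lt_floor_add_one _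
  have hr₀R : r₀ ≤ R + 1 := by
    have h1 : (r₀ : ℝ) ^ (1 / η) ≤ X :=
      le_trans (Nat.le_ceil _) (by exact_mod_cast (le_max_right _ _).trans hX)
    have h2 : (r₀ : ℝ) ≤ (X : ℝ) ^ η := by
      have := Real.rpow_le_rpow (by positivity) h1 hη.le
      rwa [← Real.rpow_mul (Nat.cast_nonneg _), one_div_mul_cancel hη.ne', Real.rpow_one] at this
    have h3 : (r₀ : ℝ) < (R : ℝ) + 1 := h2.trans_lt hRlt
    exact_mod_cast h3.le
  have key : X < t (R + 1) := by
    have h1 := hr₀ (R + 1) hr₀R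
    have h2 : (X : ℝ) < ((R + 1 : ℕ) : ℝ) ^ c := by
      have h3 : (X : ℝ) ^ η < ((R + 1 : ℕ) : ℝ) := by push_cast; exact hRlt
      have h4 : ((X : ℝ) ^ η) ^ c < ((R + 1 : ℕ) : ℝ) ^ c :=
        pow_lt_pow_left₀ h3 (Real.rpow_nonneg hX0 _) hc0
      refine lt_of_le_of_lt ?_ h4
      rw [← Real.rpow_natCast ((X : ℝ) ^ η) c, ← Real.rpow_mul hX0]
      calc (X : ℝ) = (X : ℝ) ^ (1 : ℝ) := (Real.rpow_one _).symm
        _ ≤ (X : ℝ) ^ (η * c) := Real.rpow_le_rpow_of_exponent_le hX1 hc.le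
    have h5 : (X : ℝ) < (t (R + 1) : ℕ) := h2.trans_le (by exact_mod_cast h1)
    exact_mod_cast h5
  calc (rankFor t X : ℝ) ≤ R := by exact_mod_cast rankFor_le key
    _ ≤ (X : ℝ) ^ η := by rw [hR]; exact Nat.floor_le (Real.rpow_nonneg hX0 _)

/-- `⌈√N⌉ ≤ √N + 1`. [cite: AndrewsForbes2022, Prop. 7.2 (proof, "Seed length")] -/
theorem ceilSqrt_le_sqrt_add_one (N : ℕ) : (ceilSqrt N : ℝ) ≤ Real.sqrt N + 1 := by
  have h1 : ceilSqrt N ≤ ⌈Real.sqrt N⌉₊ := by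
    refine ceilSqrt_le_iff.mpr ?_
    have h3 : Real.sqrt N ≤ ⌈Real.sqrt N⌉₊ := Nat.le_ceil _
    have h2 : (N : ℝ) ≤ (⌈Real.sqrt N⌉₊ : ℝ) * ⌈Real.sqrt N⌉₊ := by
      calc (N : ℝ) = Real.sqrt N * Real.sqrt N := (Real.mul_self_sqrt (Nat.cast_nonneg N)).symm
        _ ≤ _ := mul_le_mul h3 h3 (Real.sqrt_nonneg _) ((Real.sqrt_nonneg _).trans h3)
    exact_mod_cast h2
  calc (ceilSqrt N : ℝ) ≤ ⌈Real.sqrt N⌉₊ := by exact_mod_cast h1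
    _ ≤ Real.sqrt N + 1 := (Nat.ceil_lt_add_one (Real.sqrt_nonneg _)).le

/-- Powers of a growing `s` dominate constants: `C ≤ s^ε` for all large `s`.
[cite: AndrewsForbes2022, Prop. 7.2 (proof)] -/
theorem exists_le_rpow_of_pos (C : ℝ) {ε : ℝ} (hε : 0 < ε) :
    ∃ s₀ : ℕ, ∀ s : ℕ, s₀ ≤ s → C ≤ (s : ℝ) ^ ε := by
  refine ⟨⌈(max C 0) ^ (1 / ε)⌉₊, fun s hs => ?_⟩
  have h1 : (max C 0) ^ (1 / ε) ≤ (s : ℝ) := (Nat.le_ceil _).trans (by exact_mod_cast hs)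
  have h2 := Real.rpow_le_rpow (Real.rpow_nonneg (le_max_right _ _) _) h1 hε.le
  rw [← Real.rpow_mul (le_max_right _ _), one_div_mul_cancel hε.ne', Real.rpow_one] at h2
  exact (le_max_left _ _).trans h2

/-- One step of the size bound: `B_j + 1 = (B_{j-1} + 1)(2 r_j + 1)`. [cite: AndrewsForbes2022, Prop. 7.2 (proof, "Formula size")] -/
theorem iterFBound_cons_succ (r₁ r : ℕ) (rs : List ℕ) :
    iterFBound r₁ (r :: rs) + 1 = (iterFBound r₁ rs + 1) * (2 * r + 1) := by
  rw [iterFBound]; ring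

set_option maxHeartbeats 800000 in
/-- **The parameter analysis of Prop. 7.2** (p0037:L17–L37), quantitative: under
`t(r) ≥ r^{ω(1)}`, for every number `j + 1` of steps and every `δ ∈ (0, 1]`, for all large `s` and
all `1 ≤ ν`, `ν² ≤ s` there are ranks `r_1, [r_{j+1}, …, r_2]` (the least admissible ones)
satisfying `IterHyp`, with seed length `2 ν_j r_{j+1} ≤ ν^{2/2^{j+1}} s^δ` (`= n^{1/2^{j+1}} s^δ`)
and coordinate formula size `B_{j+1} + 1 ≤ s^δ`.  Induction on `j` as in print: the new threshold
is `≤ 16 s⁴`, so `r_{j+1} ≤ s^{o(1)}`; `ν_j ≤ √(n_j) + 1`; constants are absorbed by `s ≥ s₀`.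
[cite: AndrewsForbes2022, Prop. 7.2 (proof)] -/
theorem exists_params {t : ℕ → ℕ} (hsp : ∀ c : ℕ, ∃ r₀ : ℕ, ∀ r, r₀ ≤ r → r ^ c ≤ t r) :
    ∀ (j : ℕ) (δ : ℝ), 0 < δ → δ ≤ 1 → ∃ s₀ : ℕ, ∀ s : ℕ, s₀ ≤ s → ∀ ν : ℕ, 1 ≤ ν → ν * ν ≤ s →
      ∃ (r₁ : ℕ) (rs : List ℕ), rs.length = j ∧ IterHyp t s ν r₁ rs ∧
        ((2 * (lastSide ν r₁ rs * lastRank r₁ rs) : ℕ) : ℝ) ≤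
            (ν : ℝ) ^ ((2 : ℝ) / 2 ^ (j + 1)) * (s : ℝ) ^ δ ∧
        ((iterFBound r₁ rs + 1 : ℕ) : ℝ) ≤ (s : ℝ) ^ δ := by
  have hunb := unbounded_of_superpolynomial hsp
  intro j
  induction j with
  | zero =>
    intro δ hδ hδ1
    -- `r₁ = t⁻¹(2(s+1)ν²) ≤ (4s²)^{δ/4} ≤ 4 s^{δ/2}`
    obtain ⟨X₀, hX₀⟩ := rankFor_le_rpow hsp (η := δ / 4) (by positivity)
    obtain ⟨s₁, hs₁⟩ := exists_le_rpow_of_pos 9 (ε := δ / 2) (by positivity)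
    refine ⟨max (max 1 X₀) s₁, fun s hs ν hν hνs => ?_⟩
    have hs1 : 1 ≤ s := le_trans (le_max_left _ _) ((le_max_left _ _).trans hs)
    have hsX : X₀ ≤ s := le_trans (le_max_right _ _) ((le_max_left _ _).trans hs)
    have hss : s₁ ≤ s := (le_max_right _ _).trans hs
    have hs1R : (1 : ℝ) ≤ s := by exact_mod_cast hs1
    have hν1R : (1 : ℝ) ≤ ν := by exact_mod_cast hν
    obtain ⟨X, hX⟩ : ∃ X : ℕ, X = 2 * (s + 1) * (ν * ν) := ⟨_, rfl⟩
    refine ⟨rankFor t X, [], rfl, ?_, ?_, ?_⟩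
    · -- `IterHyp` for one step
      change 2 * (s + 1) * (ν * ν) < t (rankFor t X + 1)
      rw [← hX]
      exact lt_rankFor_spec hunb X
    all_goals
      have hXge : X₀ ≤ X := by
        rw [hX]
        calc X₀ ≤ s := hsX
          _ ≤ s * (ν * ν) := Nat.le_mul_of_pos_right s (Nat.mul_pos hν hν)
          _ ≤ 2 * (s + 1) * (ν * ν) := Nat.mul_le_mul_right (ν * ν) (by omega)
      have hXle : (X : ℝ) ≤ 4 * (s : ℝ) ^ (2 : ℝ) := by
        rw [hX, Real.rpow_two]; push_cast
        have : (ν : ℝ) * ν ≤ s := by exact_mod_cast hνs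
        nlinarith
      have hr : (rankFor t X : ℝ) ≤ 4 * (s : ℝ) ^ (δ / 2) := by
        refine (hX₀ X hXge).trans ?_
        calc (X : ℝ) ^ (δ / 4) ≤ (4 * (s : ℝ) ^ (2 : ℝ)) ^ (δ / 4) :=
              Real.rpow_le_rpow (Nat.cast_nonneg _) hXle (by positivity)
          _ = (4 : ℝ) ^ (δ / 4) * (s : ℝ) ^ (δ / 2) := by
              rw [Real.mul_rpow (by norm_num) (by positivity), ← Real.rpow_mul (by positivity)]
              ring_nf
          _ ≤ 4 * (s : ℝ) ^ (δ / 2) := by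
              refine mul_le_mul_of_nonneg_right ?_ (by positivity)
              calc (4 : ℝ) ^ (δ / 4) ≤ (4 : ℝ) ^ (1 : ℝ) :=
                    Real.rpow_le_rpow_of_exponent_le (by norm_num) (by linarith)
                _ = 4 := Real.rpow_one _
      have h9 : (9 : ℝ) ≤ (s : ℝ) ^ (δ / 2) := hs₁ s hss
      have hsq : (s : ℝ) ^ (δ / 2) * (s : ℝ) ^ (δ / 2) = (s : ℝ) ^ δ := by
        rw [← Real.rpow_add (by positivity)]; ring_nf
      have hB : ((2 * rankFor t X + 1 : ℕ) : ℝ) ≤ (s : ℝ) ^ δ := by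
        push_cast
        nlinarith [hr, h9, hsq, Real.rpow_nonneg (Nat.cast_nonneg s) (δ / 2)]
    · -- seed length `2 ν r₁ ≤ ν s^δ`
      change ((2 * (ν * rankFor t X) : ℕ) : ℝ) ≤ (ν : ℝ) ^ ((2 : ℝ) / 2 ^ (0 + 1)) * (s : ℝ) ^ δ
      have he : (ν : ℝ) ^ ((2 : ℝ) / 2 ^ (0 + 1)) = ν := by norm_num
      rw [he]
      push_cast
      have h2r : 2 * (rankFor t X : ℝ) ≤ (s : ℝ) ^ δ := by
        have := hB; push_cast at this; linarith
      nlinarith [h2r, hν1R]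
    · change ((2 * rankFor t X + 1 : ℕ) : ℝ) ≤ (s : ℝ) ^ δ
      exact hB
  | succ j ih =>
    intro δ hδ hδ1
    obtain ⟨s₁, hs₁⟩ := ih (δ / 4) (by positivity) (by linarith)
    obtain ⟨X₀, hX₀⟩ := rankFor_le_rpow hsp (η := δ / 16) (by positivity)
    obtain ⟨s₂, hs₂⟩ := exists_le_rpow_of_pos 64 (ε := δ / 4) (by positivity)
    refine ⟨max (max 1 X₀) (max s₁ s₂), fun s hs ν hν hνs => ?_⟩
    have hs1 : 1 ≤ s := le_trans (le_max_left _ _) ((le_max_left _ _).trans hs)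
    have hsX : X₀ ≤ s := le_trans (le_max_right _ _) ((le_max_left _ _).trans hs)
    have hss₁ : s₁ ≤ s := le_trans (le_max_left _ _) ((le_max_right _ _).trans hs)
    have hss₂ : s₂ ≤ s := le_trans (le_max_right _ _) ((le_max_right _ _).trans hs)
    have hs1R : (1 : ℝ) ≤ s := by exact_mod_cast hs1
    have hν1R : (1 : ℝ) ≤ ν := by exact_mod_cast hν
    have hνsR : (ν : ℝ) ≤ s := by
      have h1 : ν ≤ ν * ν := Nat.le_mul_self ν
      exact_mod_cast h1.trans hνs
    obtain ⟨r₁, rs, hlen, hhyp, hL, hB⟩ := hs₁ s hss₁ ν hν hνs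
    -- the data of the previous generator
    obtain ⟨a, ha⟩ : ∃ a : ℕ, a = lastSide ν r₁ rs := ⟨_, rfl⟩
    obtain ⟨ρ, hρ⟩ : ∃ ρ : ℕ, ρ = lastRank r₁ rs := ⟨_, rfl⟩
    obtain ⟨B, hBdef⟩ : ∃ B : ℕ, B = iterFBound r₁ rs := ⟨_, rfl⟩
    obtain ⟨ν', hν'⟩ : ∃ ν' : ℕ, ν' = ceilSqrt (a * ρ + ρ * a) := ⟨_, rfl⟩
    obtain ⟨X, hX⟩ : ∃ X : ℕ, X = 2 * (s + (s + 1) * B + 1) * (ν' * ν') := ⟨_, rfl⟩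
    have hside : ∀ r, lastSide ν r₁ (r :: rs) = ν' := fun r => by
      rw [hν', ha, hρ]; rfl
    refine ⟨r₁, rankFor t X :: rs, by rw [List.length_cons, hlen], ⟨hhyp, ?_⟩, ?_, ?_⟩
    · rw [hside, ← hBdef, ← hX]
      exact lt_rankFor_spec hunb X
    all_goals
      rw [← ha, ← hρ] at hL
      rw [← hBdef] at hB
      -- real-number bookkeeping
      have hL0 : (0 : ℝ) ≤ ((2 * (a * ρ) : ℕ) : ℝ) := Nat.cast_nonneg _
      have hpow1 : (1 : ℝ) ≤ (ν : ℝ) ^ ((2 : ℝ) / 2 ^ (j + 1)) :=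
        Real.one_le_rpow hν1R (by positivity)
      have hspos : ∀ e : ℝ, (0 : ℝ) < (s : ℝ) ^ e := fun e => Real.rpow_pos_of_pos (by positivity) e
      have hsδ1 : (1 : ℝ) ≤ (s : ℝ) ^ (δ / 4) := Real.one_le_rpow hs1R (by positivity)
      -- `ν' ≤ √L + 1 ≤ 2 ν^{1/2^{j+1}} s^{δ/8}`
      have hsqrtL : Real.sqrt ((2 * (a * ρ) : ℕ) : ℝ) ≤
          (ν : ℝ) ^ ((2 : ℝ) / 2 ^ (j + 2)) * (s : ℝ) ^ (δ / 8) := by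
        rw [Real.sqrt_eq_rpow]
        calc (((2 * (a * ρ) : ℕ) : ℝ)) ^ ((1 : ℝ) / 2)
            ≤ ((ν : ℝ) ^ ((2 : ℝ) / 2 ^ (j + 1)) * (s : ℝ) ^ (δ / 4)) ^ ((1 : ℝ) / 2) :=
              Real.rpow_le_rpow hL0 hL (by norm_num)
          _ = (ν : ℝ) ^ ((2 : ℝ) / 2 ^ (j + 2)) * (s : ℝ) ^ (δ / 8) := by
              rw [Real.mul_rpow (by positivity) (by positivity), ← Real.rpow_mul (by positivity),
                ← Real.rpow_mul (by positivity)]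
              congr 1 <;> ring_nf
      have hν'R : (ν' : ℝ) ≤ Real.sqrt ((2 * (a * ρ) : ℕ) : ℝ) + 1 := by
        rw [hν']
        have : ((a * ρ + ρ * a : ℕ) : ℝ) = ((2 * (a * ρ) : ℕ) : ℝ) := by push_cast; ring
        rw [← this]
        exact ceilSqrt_le_sqrt_add_one _
      have hpow2 : (1 : ℝ) ≤ (ν : ℝ) ^ ((2 : ℝ) / 2 ^ (j + 2)) * (s : ℝ) ^ (δ / 8) :=
        one_le_mul_of_one_le_of_one_le (Real.one_le_rpow hν1R (by positivity))
          (Real.one_le_rpow hs1R (by positivity))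
      have hν'le : (ν' : ℝ) ≤ 2 * ((ν : ℝ) ^ ((2 : ℝ) / 2 ^ (j + 2)) * (s : ℝ) ^ (δ / 8)) := by
        linarith
      -- the new threshold is `≤ 16 s⁴`
      have hLs : ((2 * (a * ρ) : ℕ) : ℝ) ≤ (s : ℝ) * s := by
        refine hL.trans ?_
        have h1 : (ν : ℝ) ^ ((2 : ℝ) / 2 ^ (j + 1)) ≤ (ν : ℝ) ^ (1 : ℝ) := by
          refine Real.rpow_le_rpow_of_exponent_le hν1R ?_
          rw [div_le_one (by positivity)]
          calc (2 : ℝ) = 2 ^ (0 + 1) := by norm_num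
            _ ≤ 2 ^ (j + 1) := pow_le_pow_right₀ (by norm_num) (by omega)
        have h2 : (s : ℝ) ^ (δ / 4) ≤ (s : ℝ) ^ (1 : ℝ) :=
          Real.rpow_le_rpow_of_exponent_le hs1R (by linarith)
        rw [Real.rpow_one] at h1 h2
        exact mul_le_mul (h1.trans hνsR) h2 (by positivity) (by positivity)
      have hν'sq : (ν' : ℝ) * ν' ≤ 2 * (s : ℝ) * s + 2 := by
        have h1 : (ν' : ℝ) * ν' ≤ (Real.sqrt ((2 * (a * ρ) : ℕ) : ℝ) + 1) ^ 2 := by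
          rw [sq]; exact mul_le_mul hν'R hν'R (Nat.cast_nonneg _) ((Nat.cast_nonneg _).trans hν'R)
        have h2 := Real.sq_sqrt hL0
        nlinarith [Real.sqrt_nonneg (((2 * (a * ρ) : ℕ) : ℝ)), h1, h2, hLs,
          sq_nonneg (Real.sqrt (((2 * (a * ρ) : ℕ) : ℝ)) - 1)]
      have hBs : ((B + 1 : ℕ) : ℝ) ≤ s := by
        refine hB.trans ?_
        calc (s : ℝ) ^ (δ / 4) ≤ (s : ℝ) ^ (1 : ℝ) :=
              Real.rpow_le_rpow_of_exponent_le hs1R (by linarith)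
          _ = s := Real.rpow_one _
      have hXle : (X : ℝ) ≤ ((16 * s ^ 4 : ℕ) : ℝ) := by
        rw [hX]; push_cast
        have hB1 : ((B : ℝ) + 1) ≤ s := by exact_mod_cast hBs
        have hν'0 : (0 : ℝ) ≤ (ν' : ℝ) * ν' := by positivity
        have hs0 : (0 : ℝ) ≤ s := by positivity
        have e1 : (s : ℝ) + 1 ≤ 2 * s := by linarith
        have hss1 : (1 : ℝ) ≤ (s : ℝ) * s := one_le_mul_of_one_le_of_one_le hs1R hs1R
        have e2 : 2 * (s : ℝ) * s + 2 ≤ 4 * (s * s) := by linarith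
        calc (2 : ℝ) * (s + (s + 1) * B + 1) * (ν' * ν') = 2 * ((s + 1) * (B + 1)) * (ν' * ν') := by ring
          _ ≤ 2 * ((s + 1) * s) * (2 * s * s + 2) := by
              refine mul_le_mul (mul_le_mul_of_nonneg_left
                (mul_le_mul_of_nonneg_left hB1 (by positivity)) (by norm_num)) hν'sq hν'0 (by positivity)
          _ ≤ 2 * ((2 * s) * s) * (4 * (s * s)) :=
              mul_le_mul (mul_le_mul_of_nonneg_left (mul_le_mul_of_nonneg_right e1 hs0) (by norm_num))
                e2 (by positivity) (by positivity)
          _ = 16 * (s : ℝ) ^ 4 := by ring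
      -- hence `r ≤ 16 s^{δ/4}`
      have hr : (rankFor t X : ℝ) ≤ 16 * (s : ℝ) ^ (δ / 4) := by
        have hX16 : X ≤ 16 * s ^ 4 := by exact_mod_cast hXle
        have hmono : rankFor t X ≤ rankFor t (16 * s ^ 4) := rankFor_mono hunb hX16
        have hge : X₀ ≤ 16 * s ^ 4 :=
          hsX.trans ((Nat.le_self_pow (by norm_num) s).trans (Nat.le_mul_of_pos_left _ (by norm_num)))
        calc (rankFor t X : ℝ) ≤ rankFor t (16 * s ^ 4) := by exact_mod_cast hmono
          _ ≤ ((16 * s ^ 4 : ℕ) : ℝ) ^ (δ / 16) := hX₀ _ hge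
          _ = (16 : ℝ) ^ (δ / 16) * (s : ℝ) ^ (δ / 4) := by
              push_cast
              rw [Real.mul_rpow (by norm_num) (by positivity), ← Real.rpow_natCast_mul (by positivity),
                show ((4 : ℕ) : ℝ) * (δ / 16) = δ / 4 by push_cast; ring]
          _ ≤ 16 * (s : ℝ) ^ (δ / 4) := by
              refine mul_le_mul_of_nonneg_right ?_ (by positivity)
              calc (16 : ℝ) ^ (δ / 16) ≤ (16 : ℝ) ^ (1 : ℝ) :=
                    Real.rpow_le_rpow_of_exponent_le (by norm_num) (by linarith)
                _ = 16 := Real.rpow_one _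
      have h64 : (64 : ℝ) ≤ (s : ℝ) ^ (δ / 4) := hs₂ s hss₂
      have hr0 : (0 : ℝ) ≤ rankFor t X := Nat.cast_nonneg _
    · -- seed length: `2 ν' r ≤ 2 · 2ν^{e/2}s^{δ/8} · 16 s^{δ/4} ≤ ν^{e/2} s^δ`
      rw [hside]
      change ((2 * (ν' * rankFor t X) : ℕ) : ℝ) ≤ (ν : ℝ) ^ ((2 : ℝ) / 2 ^ (j + 1 + 1)) * (s : ℝ) ^ δ
      push_cast
      have hprod : (s : ℝ) ^ (δ / 8) * (s : ℝ) ^ (δ / 4) * (s : ℝ) ^ (δ / 4) ≤ (s : ℝ) ^ δ := by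
        rw [← Real.rpow_add (by positivity), ← Real.rpow_add (by positivity)]
        exact Real.rpow_le_rpow_of_exponent_le hs1R (by linarith)
      have hνe0 : (0 : ℝ) ≤ (ν : ℝ) ^ ((2 : ℝ) / 2 ^ (j + 2)) := by positivity
      calc (2 : ℝ) * ((ν' : ℝ) * rankFor t X)
          ≤ 2 * ((2 * ((ν : ℝ) ^ ((2 : ℝ) / 2 ^ (j + 2)) * (s : ℝ) ^ (δ / 8))) *
              (16 * (s : ℝ) ^ (δ / 4))) := by
            refine mul_le_mul_of_nonneg_left (mul_le_mul hν'le hr hr0 (by positivity)) (by norm_num)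
        _ = (ν : ℝ) ^ ((2 : ℝ) / 2 ^ (j + 2)) * (64 * ((s : ℝ) ^ (δ / 8) * (s : ℝ) ^ (δ / 4))) := by ring
        _ ≤ (ν : ℝ) ^ ((2 : ℝ) / 2 ^ (j + 2)) *
              ((s : ℝ) ^ (δ / 8) * (s : ℝ) ^ (δ / 4) * (s : ℝ) ^ (δ / 4)) := by
            refine mul_le_mul_of_nonneg_left ?_ hνe0
            have hAB : (0 : ℝ) ≤ (s : ℝ) ^ (δ / 8) * (s : ℝ) ^ (δ / 4) :=
              le_of_lt (mul_pos (hspos _) (hspos _))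
            calc (64 : ℝ) * ((s : ℝ) ^ (δ / 8) * (s : ℝ) ^ (δ / 4))
                = ((s : ℝ) ^ (δ / 8) * (s : ℝ) ^ (δ / 4)) * 64 := by ring
              _ ≤ ((s : ℝ) ^ (δ / 8) * (s : ℝ) ^ (δ / 4)) * (s : ℝ) ^ (δ / 4) :=
                mul_le_mul_of_nonneg_left h64 hAB
        _ ≤ (ν : ℝ) ^ ((2 : ℝ) / 2 ^ (j + 1 + 1)) * (s : ℝ) ^ δ :=
            mul_le_mul_of_nonneg_left hprod hνe0
    · -- formula size: `(B + 1)(2r + 1) ≤ s^{δ/4} · 33 s^{δ/4} ≤ s^δ`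
      rw [iterFBound_cons_succ, ← hBdef]
      push_cast
      have hB' : ((B : ℝ) + 1) ≤ (s : ℝ) ^ (δ / 4) := by exact_mod_cast hB
      have hprod : (s : ℝ) ^ (δ / 4) * (s : ℝ) ^ (δ / 4) * (s : ℝ) ^ (δ / 4) ≤ (s : ℝ) ^ δ := by
        rw [← Real.rpow_add (by positivity), ← Real.rpow_add (by positivity)]
        exact Real.rpow_le_rpow_of_exponent_le hs1R (by linarith)
      calc ((B : ℝ) + 1) * (2 * (rankFor t X : ℝ) + 1)
          ≤ (s : ℝ) ^ (δ / 4) * (33 * (s : ℝ) ^ (δ / 4)) := by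
            refine mul_le_mul hB' ?_ (by positivity) (by positivity)
            nlinarith [hr, hsδ1]
        _ ≤ (s : ℝ) ^ (δ / 4) * (s : ℝ) ^ (δ / 4) * (s : ℝ) ^ (δ / 4) := by
            have h33 : (33 : ℝ) ≤ (s : ℝ) ^ (δ / 4) := by linarith
            have hA : (0 : ℝ) ≤ (s : ℝ) ^ (δ / 4) := le_of_lt (hspos _)
            calc (s : ℝ) ^ (δ / 4) * (33 * (s : ℝ) ^ (δ / 4))
                = (s : ℝ) ^ (δ / 4) * (s : ℝ) ^ (δ / 4) * 33 := by ring
              _ ≤ (s : ℝ) ^ (δ / 4) * (s : ℝ) ^ (δ / 4) * (s : ℝ) ^ (δ / 4) :=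
                mul_le_mul_of_nonneg_left h33 (mul_nonneg hA hA)
        _ ≤ (s : ℝ) ^ δ := hprod

end Proposition72

open Proposition72 in
/-- **Andrews–Forbes 2022, Proposition 7.2, bullets (1)–(3) in the printed asymptotic form —
PROVED** (every field `F`; plain-formula reading).  Let `t` be monotone, bound the border formula
complexity of every `(K_σ | K_σ)` from below by `t(σ₁)`, and be super-polynomial
(`t(r) ≥ r^{ω(1)}`: `∀ c ∃ r₀ ∀ r ≥ r₀, r^c ≤ t(r)`).  Then for every fixed `k ≥ 1` and `δ > 0`
there is `s₀` such that for all `s ≥ s₀` and all `n = ν²` with `1 ≤ ν`, `n ≤ s` (the regime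
`n ≤ s^{O(1)}` implicit in print's "`(ns)^{o(1)} ≤ s^{o(1)}`", p0037:L22), the generator
`G_k = iterGen ν r₁ [r_k, …, r_2]` with the least admissible ranks is a hitting set generator for
the closure of the `n`-variate size-`s` formulas and has
(1) seed length `≤ n^{1/2^k} · s^δ` (print: `n^{1/2^k} s^{o(1)}`),
(2) coordinates of degree `≤ 2^k` (print: `deg(G_k) = 2^k`),
(3) every coordinate computed by a fan-in-two formula with `≤ s^δ` gates, hence all `n` coordinates
by formulas of total size `≤ n s^δ` (print: "a homogeneous formula of size `n s^{o(1)}`"; the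
homogeneous reading and bullet (4) are not formalized). [cite: AndrewsForbes2022, Prop. 7.2] -/
theorem AndrewsForbes2022_prop_7_2_asymptotic (F : Type) [Field F] (t : ℕ → ℕ) (ht : Monotone t)
    (hyp : ∀ (n' m' : ℕ) (σ : Multiset ℕ), σ ≠ 0 → (∀ p ∈ σ, 0 < p ∧ p ≤ min n' m') →
      t σ.sup ≤ borderFormulaComplexity F (kBideterminant F n' m' σ))
    (hsp : ∀ c : ℕ, ∃ r₀ : ℕ, ∀ r, r₀ ≤ r → r ^ c ≤ t r)
    (k : ℕ) (hk : 1 ≤ k) (δ : ℝ) (hδ : 0 < δ) :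
    ∃ s₀ : ℕ, ∀ s : ℕ, s₀ ≤ s → ∀ ν : ℕ, 1 ≤ ν → ν * ν ≤ s →
      ∃ (r₁ : ℕ) (rs : List ℕ), rs.length + 1 = k ∧
        IsHittingSetGenFor F (borderClass F (formulaClass (LaurentSeries F) (Fin ν × Fin ν) s))
          (iterGen F ν r₁ rs) ∧
        (Fintype.card (IterSeed ν r₁ rs) : ℝ) ≤ ((ν * ν : ℕ) : ℝ) ^ ((1 : ℝ) / 2 ^ k) * (s : ℝ) ^ δ ∧
        (∀ m, (iterGen F ν r₁ rs m).totalDegree ≤ 2 ^ k) ∧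
        ∀ m, (formulaComplexity (iterGen F ν r₁ rs m) : ℝ) ≤ (s : ℝ) ^ δ := by
  obtain ⟨j, rfl⟩ : ∃ j, k = j + 1 := ⟨k - 1, by omega⟩
  obtain ⟨s₀, hs₀⟩ := exists_params hsp j (min δ 1) (lt_min hδ one_pos) (min_le_right _ _)
  refine ⟨max 1 s₀, fun s hs ν hν hνs => ?_⟩
  have hs1R : (1 : ℝ) ≤ s := by exact_mod_cast (le_max_left _ _).trans hs
  obtain ⟨r₁, rs, hlen, hhyp, hL, hB⟩ := hs₀ s ((le_max_right _ _).trans hs) ν hν hνs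
  have hmin : (s : ℝ) ^ (min δ 1) ≤ (s : ℝ) ^ δ :=
    Real.rpow_le_rpow_of_exponent_le hs1R (min_le_left _ _)
  refine ⟨r₁, rs, by rw [hlen], iterGen_isHittingSetGenFor ht hyp s ν r₁ rs hhyp, ?_, ?_, ?_⟩
  · rw [card_iterSeed]
    refine hL.trans ?_
    have he : ((ν * ν : ℕ) : ℝ) ^ ((1 : ℝ) / 2 ^ (j + 1)) = (ν : ℝ) ^ ((2 : ℝ) / 2 ^ (j + 1)) := by
      push_cast
      rw [← sq, ← Real.rpow_natCast_mul (Nat.cast_nonneg _)]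
      congr 1
      push_cast
      ring
    rw [he]
    exact mul_le_mul_of_nonneg_left hmin (by positivity)
  · intro m
    simpa [hlen] using totalDegree_iterGen_le (F := F) ν r₁ rs m
  · intro m
    have h1 : (formulaComplexity (iterGen F ν r₁ rs m) : ℝ) ≤ ((iterFBound r₁ rs + 1 : ℕ) : ℝ) := by
      exact_mod_cast (formulaComplexity_iterGen_le (F := F) ν r₁ rs m).trans (Nat.le_succ _)
    exact h1.trans (hB.trans hmin)

end Asymptotic

end Literature.Computability.AlgebraicComplexity
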